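import Summits.BirchSwinnertonDyer.Rank1Residual.Additive.GordStableLine
import Summits.BirchSwinnertonDyer.Rank1Residual.Additive.CyclotomicSubfields
import Mathlib.FieldTheory.Galois.Abelian
import HarnessLib

/-!
# `E(F)[p] = 0` over every (G)-field — indeed over every abelian number field of degree dividing `p − 1` — when `E[p]` is irreducible

HONEST FRAMING (cell `b2b-bsdres`, run/shared/lean/b2b/bsd-rank1-residual/, verbatim in every
file): the goal of the cell is to DELETE the COMBINATION-SHAPED residual classes of the
Birch–Swinnerton-Dyer formula for ALL analytic-rank `≤ 1` elliptic curves over `ℚ` — "full BSD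
formula for every rank `≤ 1` curve in class `C`" assembled STRICTLY from published theorems — so
that the rank-`≤ 1` remainder becomes exactly the CONSTRUCTION-SHAPED classes, which are TYPED
(missing-input `Prop`s), NOT attempted. This is not "finishing BSD". Sub-cell `additive-p2`
(X3♯(G-ord) / X4♯(G-ord)), generation 11: research route; no claim beyond the stated classes;
theorems only, no definition, no named fact, nothing booked, no label moved.

## What is proved

The torsion hypothesis of every Euler-characteristic / control / Kolyvagin argument over a
(G)-field — "`E(F)[p] = 0`", the term `#E(F)[p^∞]` of Greenberg's Theorem 4.1 over `F` (LNM 1716;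
tree fact `Greenberg1999.thm41_charValue_rankZero_numberField`), (tor) of
Burungale–Castella–Grossi–Skinner — is AUTOMATIC on class X4 (irreducible `E[p]`) over every field
the sub-cell's descent uses:

* `torsionBy_eq_bot_of_isAbelianGalois_of_finrank_dvd` — **for `K/ℚ` ABELIAN (Galois with
  commutative group) of degree `[K : ℚ] ∣ p − 1` and `E[p]` an irreducible `Γ_ℚ`-module,
  `E(K)[p] = 0`.** The tree had the quadratic case (`[K : ℚ] = 2`,
  `torsionBy_eq_bot_of_hasIrreducibleModPGaloisRep`, file `BSDSelmerCMPConverseHeegnerFieldProofs`,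
  after Gross 1991 §2); the proof here follows it — pull a `K`-rational `p`-torsion point back to
  `0 ≠ Q ∈ E[p] = E(ℚ̄)[p]` along `pointsMap` (bijective, `res`-equivariant), `Q` is fixed by
  `res(Γ_K)` — and replaces "squares of `Γ_ℚ`" by the KERNEL of the restriction
  `r : Γ_ℚ → Gal(K/ℚ)` (`exists_restrictNormalHom`: Mathlib's `AlgEquiv.restrictNormalHom` for the
  algebra structure `K → ℚ̄` of the tree's embedding, + `exists_resGal_eq_of_forall_apply_eq`): the
  fixed subgroup `E[p]^{ker r}` is `Γ_ℚ`-stable and non-zero, hence everything (irr), so `Γ_ℚ` acts on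
  `E[p]` through the abelian group `Gal(K/ℚ)` of order `[K : ℚ] ∣ p − 1`: COMMUTATIVELY and with
  `σ^{p−1} = 1`; then (support file `Additive/GordStableLine.lean`)
* `exists_stable_addSubgroup_of_comm_of_pow_smul` (the linear algebra) — a commuting family of
  automorphisms `g` with `g^{p−1} = 1` of an `𝔽_p`-plane (`#M = p²`, `pM = 0`) fixes a LINE: either
  every `g` is a scalar, or some `g` is a non-scalar endomorphism killed by
  `X^p − X = ∏_{a ∈ 𝔽_p}(X − a)` (which splits over `𝔽_p`: Mathlib `FiniteField.isSplittingField_sub`,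
  `splits_X_pow_sub_X`), so its minimal polynomial splits, it has an eigenvalue in `𝔽_p`
  (`Module.End.hasEigenvalue_of_isRoot`) and the eigenspace is a proper non-zero subgroup stable
  under everything commuting with `g` — contradicting (irr) (`#E[p] = p²`, tree fact
  `card_torsionPoints_eq_sq_holds`);
* `torsionBy_eq_bot_of_algHom_cyclotomic`, `torsionBy_eq_bot_intermediateField_cyclotomic`,
  `torsionBy_eq_bot_cyclotomic` — every number field embedding into `ℚ(ζ_p)`, every subfield
  `F ⊆ ℚ(ζ_p)` (the (G)-fields of Delbourgo 1998 §1.5 / the tree's `TypeG`: abelian over `ℚ`,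
  degree `∣ p − 1`), and `ℚ(ζ_p)` itself; in Greenberg's currency
  `natCard_primaryComponent_point_cyclotomic_eq_one` (**`#E(ℚ(ζ_p))[p^∞] = 1`**),
  `natCard_primaryComponent_point_intermediateField_cyclotomic_eq_one`; class level
  `ClassX4.torsionBy_eq_bot_intermediateField_cyclotomic`.

Sharpness: abelian of exponent NOT dividing `p − 1` does not suffice (a cyclic non-split Cartan
image is abelian and irreducible); "each element has order dividing `p − 1`" without commutativity
does not suffice either (the normaliser of a split Cartan has exponent `p − 1` for suitable `p` and
acts irreducibly) — both hypotheses are used. On X3 (reducible `E[p]`) the statement is false in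
general (rational `p`-torsion / `μ_p ⊂ E[p]` over `ℚ(ζ_p)`).

Use: the term `2·ord_p #V(F)[p]` (`F = ℚ(μ_p)`, `V = E` or its twist `E^{(p*)}`, `V[p] ≅ E[p] ⊗ χ`
irreducible too) of additive-p4's line-V19 inequality (REPAIR-CENSUS V19, "per-row certificate
`V(ℚ(μ_p))[p] = 0` by `elltors` over nf") VANISHES identically on X4 — no certificate needed; and
(tor) over the minimal (G)-field `F₀` / over the ramified quadratic descent fields `ℚ(√(p*·d'))`
(`[K : ℚ] = 2 ∣ p − 1`, already the tree's quadratic case) holds on all of X4♯(G-ord).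

References: B. H. Gross, *Kolyvagin's work on modular elliptic curves* (1991) §2; R. Greenberg,
LNM 1716 (1999) Thm. 4.1; J.-P. Serre, Invent. Math. 15 (1972) §2 (Cartan subgroups and their
normalisers); D. Delbourgo, Compositio Math. 113 (1998) §1.5 (G).
-/

noncomputable section

open scoped Classical

open WeierstrassCurve Polynomial

namespace Summit.BirchSwinnertonDyer.Rank1Residual.Additive

/-! ## Part C. `E(K)[p] = 0` over abelian `K` of degree dividing `p − 1` -/

section Torsion

open Field (absoluteGaloisGroup)
open Field.absoluteGaloisGroup (toAlgEquiv)
open Literature.NumberTheory.EllipticCurves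

variable (K : Type) [Field K] [NumberField K] (W : WeierstrassCurve ℚ) [W.IsElliptic]

/-- **`E(K)[p] = 0` over an ABELIAN number field `K` (in `Type`) with `[K : ℚ] ∣ p − 1` when
`E[p]` is an irreducible `Γ_ℚ`-module** — e.g. over every subfield of `ℚ(ζ_p)`, in particular over
every (G)-field of an X4 pair (Delbourgo 1998 §1.5) and over the cyclotomic field `ℚ(ζ_p)` of the
cell's line V19. Argument: pull a `K`-rational `p`-torsion point back to `0 ≠ Q ∈ E[p] = E(ℚ̄)[p]`
(`pointsMap`, bijective, `res`-equivariant — verbatim as in the tree's quadratic case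
`torsionBy_eq_bot_of_hasIrreducibleModPGaloisRep_type`); `Q` is fixed by `res(Γ_K)`, hence by the
kernel `N` of the restriction `r : Γ_ℚ → Gal(K/ℚ)` (`exists_restrictNormalHom`,
`exists_resGal_eq_of_forall_apply_eq`); the subgroup `E[p]^N` is `Γ_ℚ`-stable (`N` is normal) and
non-zero, so equals `E[p]` by (irr): `Γ_ℚ` acts on `E[p]` through the ABELIAN group `Gal(K/ℚ)` of
order `[K : ℚ] ∣ p − 1` — commutatively and with `σ^{p−1} = 1`. By
`exists_stable_addSubgroup_of_comm_of_pow_smul` (`#E[p] = p²`, tree fact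
`card_torsionPoints_eq_sq_holds`) some line is stable, contradicting (irr). The hypothesis
`[K : ℚ] ∣ p − 1` is sharp in the sense that an abelian image of exponent not dividing `p − 1` can
be irreducible (non-split Cartan). Gross 1991 §2 proves the quadratic case for surjective `ρ̄`.
[cite: GrossLMS1991, §2 (sentence after (2.2))] -/
theorem torsionBy_eq_bot_of_isAbelianGalois_of_finrank_dvd [IsAbelianGalois ℚ K] {p : ℕ}
    (hp : p.Prime) (hdeg : Module.finrank ℚ K ∣ p - 1) (hirr : W.HasIrreducibleModPGaloisRep p) :
    AddSubgroup.torsionBy (W.baseChange K).toAffine.Point (p : ℤ) = ⊥ := by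
  rw [eq_bot_iff]
  intro P hP
  rw [AddSubgroup.mem_bot]
  by_contra hP0
  have hPp : p • P = 0 := AddSubgroup.torsionBy.nsmul_iff.mp hP
  -- the point over `K̄` and its preimage `Q` over `ℚ̄`
  let f : K →ₐ[ℚ] AlgebraicClosure K := (algebraMap K (AlgebraicClosure K)).toRatAlgHom
  let φ : (W.baseChange K).toAffine.Point →+ localPoints W K :=
    WeierstrassCurve.Affine.Point.map f
  have hφ : Function.Injective φ := WeierstrassCurve.Affine.Point.map_injective _
  obtain ⟨Q, hQ⟩ := (pointsMapOfEmb_bijective K W (closureEmb (K := ℚ) K)).2 (φ P)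
  have hQ' : pointsMap W K Q = φ P := hQ
  have hinj : Function.Injective (pointsMap W K) :=
    (pointsMapOfEmb_bijective K W (closureEmb (K := ℚ) K)).1
  have hQ0 : Q ≠ 0 := by
    rintro rfl
    apply hP0
    apply hφ
    rw [map_zero, ← hQ', map_zero]
  have hQp : p • Q = 0 := by
    apply hinj
    rw [map_nsmul, map_zero, hQ', ← map_nsmul, hPp, map_zero]
  -- `Q` is fixed by `Γ_K`
  have hfixK : ∀ τ : absoluteGaloisGroup K, resGal (K := ℚ) K τ • Q = Q := by
    intro τ
    apply hinj
    rw [pointsMap_smul, hQ']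
    change WeierstrassCurve.Affine.Point.map
        ((AlgEquiv.restrictScalars ℚ (toAlgEquiv K τ) :
            AlgebraicClosure K ≃ₐ[ℚ] AlgebraicClosure K) :
          AlgebraicClosure K →ₐ[ℚ] AlgebraicClosure K)
        (WeierstrassCurve.Affine.Point.map f P) =
      WeierstrassCurve.Affine.Point.map f P
    have hgf : ((AlgEquiv.restrictScalars ℚ (toAlgEquiv K τ) :
            AlgebraicClosure K ≃ₐ[ℚ] AlgebraicClosure K) :
          AlgebraicClosure K →ₐ[ℚ] AlgebraicClosure K).comp f = f := by
      ext x
      exact (toAlgEquiv K τ).commutes x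
    rw [WeierstrassCurve.Affine.Point.map_map, hgf]
  -- hence by the kernel of the restriction `r : Γ_ℚ → Gal(K/ℚ)`
  obtain ⟨r, hr⟩ := exists_restrictNormalHom K
  have hker : ∀ ρ : absoluteGaloisGroup ℚ, r ρ = 1 → ρ • Q = Q := by
    intro ρ hρ
    obtain ⟨τ, hτ⟩ := exists_resGal_eq_of_forall_apply_eq K (ρ := ρ) fun x ↦ by
      rw [hr ρ x, hρ, AlgEquiv.one_apply]
    rw [← hτ]
    exact hfixK τ
  -- `Gal(K/ℚ)` is abelian of order `[K : ℚ] ∣ p − 1`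
  have hcommK : ∀ a b : absoluteGaloisGroup ℚ, r (a⁻¹ * b⁻¹ * a * b) = 1 := by
    intro a b
    rw [map_mul, map_mul, map_mul, map_inv, map_inv, mul_assoc, mul_comm' (r a) (r b), ← mul_assoc,
      inv_mul_cancel_right, inv_mul_cancel]
  have hpowK : ∀ a : absoluteGaloisGroup ℚ, r (a ^ (p - 1)) = 1 := by
    intro a
    obtain ⟨k, hk⟩ := hdeg
    have hcard : Nat.card (K ≃ₐ[ℚ] K) = Module.finrank ℚ K := IsGalois.card_aut_eq_finrank ℚ K
    rw [map_pow, hk, pow_mul, ← hcard, pow_card_eq_one', one_pow]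
  -- the Galois module `E[p]`, of order `p²`
  haveI : Fact p.Prime := ⟨hp⟩
  let M := ↥(WeierstrassCurve.geomTorsion W (p : ℤ))
  have hcardM : Nat.card M = p ^ 2 := by
    have := WeierstrassCurve.card_torsionPoints_eq_sq_holds W (AlgebraicClosure ℚ) (n := p)
      (by exact_mod_cast hp.ne_zero)
    exact this
  let Qm : M := ⟨Q, AddSubgroup.torsionBy.nsmul_iff.mpr hQp⟩
  have hQm0 : Qm ≠ 0 := fun h ↦ hQ0 (congrArg Subtype.val h)
  -- the subgroup fixed by `ker r` is stable and contains `Q`, hence is everything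
  let H₁ : AddSubgroup M :=
    { carrier := {R | ∀ ρ : absoluteGaloisGroup ℚ, r ρ = 1 → ρ • R = R}
      zero_mem' := fun ρ _ ↦ smul_zero _
      add_mem' := by
        intro u v hu hv ρ hρ
        rw [smul_add, hu ρ hρ, hv ρ hρ]
      neg_mem' := by
        intro u hu ρ hρ
        rw [smul_neg, hu ρ hρ] }
  have hH₁stab : ∀ σ : absoluteGaloisGroup ℚ, ∀ R ∈ H₁, σ • R ∈ H₁ := by
    intro τ R hR ρ hρ
    show ρ • τ • R = τ • R
    have hconj : ρ * τ = τ * (τ⁻¹ * ρ * τ) := by group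
    have hρ' : r (τ⁻¹ * ρ * τ) = 1 := by
      rw [map_mul, map_mul, map_inv, hρ, mul_one, inv_mul_cancel]
    rw [← mul_smul, hconj, mul_smul, hR _ hρ']
  have hQmH₁ : Qm ∈ H₁ := fun ρ hρ ↦ Subtype.ext (hker ρ hρ)
  have hirr' : ∀ H : AddSubgroup M,
      (∀ σ : absoluteGaloisGroup ℚ, ∀ R ∈ H, σ • R ∈ H) → H = ⊥ ∨ H = ⊤ := hirr
  have hH₁top : H₁ = ⊤ := by
    refine (hirr' H₁ hH₁stab).resolve_left fun hbot ↦ hQm0 ?_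
    rw [hbot] at hQmH₁
    exact (AddSubgroup.mem_bot).mp hQmH₁
  have hkerM : ∀ ρ : absoluteGaloisGroup ℚ, r ρ = 1 → ∀ R : M, ρ • R = R := by
    intro ρ hρ R
    have hR : R ∈ H₁ := hH₁top ▸ AddSubgroup.mem_top R
    exact hR ρ hρ
  -- so `Γ_ℚ` acts on `E[p]` commutatively with `σ^{p−1} = 1`
  have comm : ∀ (a b : absoluteGaloisGroup ℚ) (R : M), (a * b) • R = (b * a) • R := by
    intro a b R
    have h1 : a * b = b * a * (a⁻¹ * b⁻¹ * a * b) := by group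
    rw [h1, mul_smul (b * a), hkerM _ (hcommK a b)]
  have hpowM : ∀ (a : absoluteGaloisGroup ℚ) (R : M), (a ^ (p - 1)) • R = R :=
    fun a R ↦ hkerM _ (hpowK a) R
  have hpM : ∀ R : M, p • R = 0 := fun R ↦
    Subtype.ext (AddSubgroup.torsionBy.nsmul_iff.mp R.2)
  obtain ⟨H, hHstab, hHbot, hHtop⟩ :=
    exists_stable_addSubgroup_of_comm_of_pow_smul hpM hcardM comm hpowM
  rcases hirr' H hHstab with h | h
  · exact hHbot h
  · exact hHtop h

end Torsion

/-! ## Part D. The (G)-fields: subfields of `ℚ(ζ_p)`; Greenberg's currency `#E(F)[p^∞] = 1` -/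

section Cyclotomic

open Literature.NumberTheory.EllipticCurves.Rank1Residual

/-- `p`-torsion-freeness gives a trivial `p`-primary part: if `A[p] = 0` then `A[p^∞] = 0`, i.e.
`#A[p^∞] = 1` (induction on the exponent). [folklore] -/
theorem natCard_primaryComponent_eq_one_of_torsionBy_eq_bot {A : Type*} [AddCommGroup A] {p : ℕ}
    [Fact p.Prime] (h : AddSubgroup.torsionBy A (p : ℤ) = ⊥) :
    Nat.card (AddCommGroup.primaryComponent A p) = 1 := by
  have key : ∀ (n : ℕ) (g : A), p ^ n • g = 0 → g = 0 := by
    intro n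
    induction n with
    | zero => intro g hg; simpa using hg
    | succ n ih =>
      intro g hg
      have h1 : p ^ n • (p • g) = 0 := by rw [← mul_nsmul', ← pow_succ, hg]
      have h2 : p • g = 0 := ih _ h1
      have hmem : g ∈ AddSubgroup.torsionBy A (p : ℤ) := AddSubgroup.torsionBy.nsmul_iff.mpr h2
      rw [h] at hmem
      exact (AddSubgroup.mem_bot).mp hmem
  have hbot : AddCommGroup.primaryComponent A p = ⊥ := by
    refine (AddSubgroup.eq_bot_iff_forall _).mpr fun g hg ↦ ?_
    obtain ⟨n, hn⟩ := (AddCommGroup.mem_primaryComponent (G := A) (p := p)).mp hg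
    exact key n g hn
  rw [hbot, AddSubgroup.card_bot]

variable (W : WeierstrassCurve ℚ) [W.IsElliptic] (p : ℕ) [hp : Fact p.Prime]
  {L : Type} [Field L] [NumberField L] [IsCyclotomicExtension {p} ℚ L]

/-- **`E(K)[p] = 0` for every number field `K` that EMBEDS into the `p`-th cyclotomic field,
when `E[p]` is irreducible**: such `K` is abelian over `ℚ` (Mathlib `IsAbelianGalois.of_algHom`,
`IsCyclotomicExtension.isAbelianGalois`) of degree dividing `p − 1 = [ℚ(ζ_p) : ℚ]`. This covers
every (G)-field of an X4 pair — Delbourgo's hypothesis (G), Compositio 113 (1998) §1.5, places the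
field of good reduction inside `ℚ(μ_p)` — in particular the minimal one `F₀`, and `ℚ(ζ_p)` itself.
[folklore] -/
theorem torsionBy_eq_bot_of_algHom_cyclotomic (K : Type) [Field K] [NumberField K] (f : K →ₐ[ℚ] L)
    (hirr : W.HasIrreducibleModPGaloisRep p) :
    AddSubgroup.torsionBy ((W.baseChange K).toAffine.Point) (p : ℤ) = ⊥ := by
  haveI hL : IsAbelianGalois ℚ L := IsCyclotomicExtension.isAbelianGalois {p} ℚ L
  haveI : IsAbelianGalois ℚ K := IsAbelianGalois.of_algHom f
  have hdvd : Module.finrank ℚ K ∣ p - 1 := by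
    letI : Algebra K L := f.toRingHom.toAlgebra
    haveI : IsScalarTower ℚ K L := IsScalarTower.of_algebraMap_eq' f.comp_algebraMap.symm
    haveI : Module.Finite K L := Module.Finite.of_restrictScalars_finite ℚ K L
    have hL' : Module.finrank ℚ L = p - 1 := by
      rw [IsCyclotomicExtension.finrank L (Polynomial.cyclotomic.irreducible_rat hp.out.pos),
        Nat.totient_prime hp.out]
    rw [← hL']
    exact Dvd.intro _ (Module.finrank_mul_finrank ℚ K L)
  exact torsionBy_eq_bot_of_isAbelianGalois_of_finrank_dvd K W hp.out hdvd hirr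

/-- **`E(F)[p] = 0` over every subfield `F ⊆ ℚ(ζ_p)`** (intermediate-field form of
`torsionBy_eq_bot_of_algHom_cyclotomic`, for the tree's (G)-fields `F : IntermediateField ℚ L` of
`TypeG`). [folklore] -/
theorem torsionBy_eq_bot_intermediateField_cyclotomic (F : IntermediateField ℚ L)
    (hirr : W.HasIrreducibleModPGaloisRep p) :
    AddSubgroup.torsionBy ((W.baseChange F).toAffine.Point) (p : ℤ) = ⊥ := by
  haveI : NumberField F := NumberField.of_module_finite ℚ F
  -- (`convert`: the decidable-equality instance on `↥F` used by the point group is not the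
  -- classical one of the general theorem; `DecidableEq` is a subsingleton)
  convert torsionBy_eq_bot_of_algHom_cyclotomic W p (↥F) (algebraMap F L).toRatAlgHom hirr

/-- **`E(ℚ(ζ_p))[p] = 0` when `E[p]` is irreducible** — the torsion term `#E(F)[p^∞]` of
Greenberg's Thm. 4.1 over `F = ℚ(μ_p)` (LNM 1716; tree fact `thm41_charValue_rankZero_numberField`,
the field of the cell's line V19) is `1` on every X4 pair:
`natCard_primaryComponent_point_cyclotomic_eq_one`. [folklore] -/
theorem torsionBy_eq_bot_cyclotomic (hirr : W.HasIrreducibleModPGaloisRep p) :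
    AddSubgroup.torsionBy ((W.baseChange L).toAffine.Point) (p : ℤ) = ⊥ := by
  haveI : IsAbelianGalois ℚ L := IsCyclotomicExtension.isAbelianGalois {p} ℚ L
  refine torsionBy_eq_bot_of_isAbelianGalois_of_finrank_dvd L W hp.out ?_ hirr
  rw [IsCyclotomicExtension.finrank L (Polynomial.cyclotomic.irreducible_rat hp.out.pos),
    Nat.totient_prime hp.out]

/-- Greenberg's currency over `F = ℚ(ζ_p)`: **`#E(ℚ(ζ_p))[p^∞] = 1`** for irreducible `E[p]`. -/
theorem natCard_primaryComponent_point_cyclotomic_eq_one (hirr : W.HasIrreducibleModPGaloisRep p) :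
    Nat.card (AddCommGroup.primaryComponent (W.baseChange L).toAffine.Point p) = 1 :=
  natCard_primaryComponent_eq_one_of_torsionBy_eq_bot (torsionBy_eq_bot_cyclotomic W p hirr)

/-- The same over any subfield `F ⊆ ℚ(ζ_p)` (every (G)-field): **`#E(F)[p^∞] = 1`**. -/
theorem natCard_primaryComponent_point_intermediateField_cyclotomic_eq_one
    (F : IntermediateField ℚ L) (hirr : W.HasIrreducibleModPGaloisRep p) :
    Nat.card (AddCommGroup.primaryComponent (W.baseChange F).toAffine.Point p) = 1 :=
  natCard_primaryComponent_eq_one_of_torsionBy_eq_bot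
    (torsionBy_eq_bot_intermediateField_cyclotomic W p F hirr)

/-- **Class level, X4** (`p` odd, additive at `p`, `E[p]` irreducible): no `p`-torsion over any
subfield of `ℚ(ζ_p)` — the (tor)-type hypothesis of every Euler-characteristic argument over a
(G)-field is automatic on X4 (on X3 it fails by definition: `E[p]` is reducible there). -/
theorem ClassX4.torsionBy_eq_bot_intermediateField_cyclotomic [W.IsGloballyMinimal]
    (hX : ClassX4 W p) (F : IntermediateField ℚ L) :
    AddSubgroup.torsionBy ((W.baseChange F).toAffine.Point) (p : ℤ) = ⊥ :=
  Summit.BirchSwinnertonDyer.Rank1Residual.Additive.torsionBy_eq_bot_intermediateField_cyclotomic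
    W p F hX.2.2

end Cyclotomic



end Summit.BirchSwinnertonDyer.Rank1Residual.Additive

end
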